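import Literature.Topology.FourManifolds.LatticeFormsHyperbolicRankSixModTwo
import Literature.Topology.FourManifolds.LatticeFormsHyperbolicSumDiscriminantForm
import Literature.Topology.FourManifolds.LatticeFormsDiscriminantFormIsometry
import Mathlib.Algebra.Module.ZMod
import HarnessLib

/-!
# `O(U(2)^{⊕3}) → O(q_{U(2)^{⊕3}})` is surjective (Nikulin 1980, Thm. 1.14.2 for `U(2)^{⊕3}`; the lifting
# hypothesis of Huybrechts' Cor. 14.3.15)

D. Huybrechts, *Lectures on K3 Surfaces*, Ch. 14: Thm. 2.4 / Rem. 1.13 (i) (Nikulin's Thm. 1.14.2) assert that for an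
even indefinite lattice `Λ` with `rk Λ ≥ ℓ(A_Λ) + 2` — and, in the refined form, in the boundary cases where
`q_{Λ} ⊗ ℤ_p` splits off `u₊(p)` — the natural map `O(Λ) → O(A_Λ, q_Λ)` is ONTO. The instance needed for Cor. 3.15
(uniqueness of the Kummer lattice in `H²(X, ℤ)`, reduced to exactly this statement in
`KummerLatticeK3EmbeddingUniqueness.lean`, hypothesis `hlift`) is `Λ = K^⊥ ≅ U(2)^{⊕3}` (Prop. 3.14 (i)): rank `6 =
ℓ(A) = 6`, the boundary case. This file PROVES it: **every isometry of the discriminant form of `U(2)^{⊕3}` is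
induced by an isometry of `U(2)^{⊕3}`** (`forall_lift_two_smul_hyperbolicSum_three`). Proof: `O(U(2)^{⊕3}) =
O(U^{⊕3})`, and `A_{U(2)^{⊕3}} = U^{⊕3}/2U^{⊕3} = 𝔽₂⁶` with `q(x/2) = ½(x.x) mod 2ℤ ↔ q̄(v) = v₁v₂ + v₃v₄ + v₅v₆`
(the dictionary of §2, from `discriminantGroupSmulEquivPiZMod` and `discriminantQuad_two_smul_hyperbolicSum_mk`);
under this dictionary `ḡ` is the reduction of `g` modulo `2`, and every `q̄`-orthogonal automorphism of `𝔽₂⁶` is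
the reduction of an integral isometry (`exists_integral_lift_of_orthogonal_mod_two`, the kernel-checked stabiliser
chain of `LatticeFormsHyperbolicRankSixModTwo.lean`). Written for lane `lit-hodgefound` (Track 2 foundations; prover
seat `lit-hodgefound-p18`, gen 33, row g33-#10). DEFINITIONS WITH BODIES (coordinates, the matrix isometries, the
dictionary) and THEOREMS; no named fact, no instance, no notation.

## Source

* D. Huybrechts, *Lectures on K3 Surfaces*, CUP 2016, Ch. 14 Thm. 2.4, Rem. 1.13 (i), Prop. 3.14, Cor. 3.15 (held
  text `book:huybrechtsnd-lectures-k3-surfaces`, p0344, p0341, p0351–p0352); V. V. Nikulin, Math. USSR Izv. 14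
  (1980), Thm. 1.14.2 (cited through Huybrechts).

## Contents

* §1 coordinates `hypSixCoord : U^{⊕3} ⥲ ℤ^{Fin 3 ⊕ Fin 3}`, `(p.q) = φp ⬝ G φq`, and the isometry `hypSixIsometryEquiv M`
  of `U^{⊕3}` (and of `U(2)^{⊕3}`) attached to an integral `M` with `Mᵀ G M = G` and an integral inverse;
* §2 the dictionary `hypSixTheta : A_{U(2)^{⊕3}} ⥲ 𝔽₂⁶`, `Θ[i_U(x)] = x mod 2`, with
  `q(a) = q̄(Θ a) mod 2ℤ` (`discriminantQuad_eq_hypSixQuadTwo`);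
* §3 **`forall_lift_two_smul_hyperbolicSum_three`**: `∀ δ ∈ O(A, q), ∃ g ∈ O(U(2)^{⊕3}), ḡ = δ`.

## References

* [Huybrechts2016K3] D. Huybrechts, Lectures on K3 Surfaces, CUP 2016, Ch. 14 Thm. 2.4, Rem. 1.13 (i), Prop. 3.14,
  Cor. 3.15.
* [Nikulin1980] V. V. Nikulin, Integral symmetric bilinear forms and some of their applications, Math. USSR Izv. 14
  (1980) 103–167, Thm. 1.14.2.
-/

noncomputable section

open Module Function
open LinearMap (BilinForm)
open scoped Matrix

namespace Literature.Topology.FourManifolds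

open LinearMap.BilinForm

/-! ### §1 Coordinates on `U^{⊕3}` and the isometries attached to integral matrices -/

/-- Coordinates `U^{⊕3} = ℤ³ × ℤ³ ⥲ ℤ^{Fin 3 ⊕ Fin 3}`, `(x, y) ↦ (inl p ↦ x p, inr p ↦ y p)` (`eₚ ↔ inl p`,
`fₚ ↔ inr p`). [cite: Huybrechts2016K3, Ch. 14 §0.3 (ii)] -/
def hypSixCoord : ((Fin 3 → ℤ) × (Fin 3 → ℤ)) ≃ₗ[ℤ] (Fin 3 ⊕ Fin 3 → ℤ) :=
  (LinearEquiv.sumArrowLequivProdArrow (Fin 3) (Fin 3) ℤ ℤ).symm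

/-- `φ(x, y) = Sum.elim x y`. [cite: Huybrechts2016K3, Ch. 14 §0.3 (ii)] -/
theorem hypSixCoord_apply (p : (Fin 3 → ℤ) × (Fin 3 → ℤ)) : hypSixCoord p = Sum.elim p.1 p.2 := by
  ext (i | i)
  · exact LinearEquiv.sumArrowLequivProdArrow_symm_apply_inl p.1 p.2 i
  · exact LinearEquiv.sumArrowLequivProdArrow_symm_apply_inr p.1 p.2 i

/-- **`(p.q)_{U^{⊕3}} = φp ⬝ (G φq)`**: the Gram matrix `hypSixGram` computes the form in coordinates.
[cite: Huybrechts2016K3, Ch. 14 §0.3 (ii)] -/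
theorem hyperbolicSum_three_eq_dotProduct (p q : (Fin 3 → ℤ) × (Fin 3 → ℤ)) :
    hyperbolicSum 3 p q = hypSixCoord p ⬝ᵥ (hypSixGram *ᵥ hypSixCoord q) := by
  rw [hyperbolicSum_apply, hypSixCoord_apply, hypSixCoord_apply, hypSixGram, Matrix.fromBlocks_mulVec,
    Sum.elim_comp_inl, Sum.elim_comp_inr, Matrix.zero_mulVec, Matrix.zero_mulVec, Matrix.one_mulVec,
    Matrix.one_mulVec, zero_add, add_zero, sumElim_dotProduct_sumElim]

/-- An integral `M` with `Mᵀ G M = G` preserves `v ⬝ (G w)`. [cite: Huybrechts2016K3, Ch. 14 §0.1 ("orthogonal group O(Λ)")] -/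
theorem dotProduct_mulVec_eq_of_transpose_mul_mul {M : Matrix (Fin 3 ⊕ Fin 3) (Fin 3 ⊕ Fin 3) ℤ}
    (hG : Mᵀ * hypSixGram * M = hypSixGram) (v w : Fin 3 ⊕ Fin 3 → ℤ) :
    (M *ᵥ v) ⬝ᵥ (hypSixGram *ᵥ (M *ᵥ w)) = v ⬝ᵥ (hypSixGram *ᵥ w) := by
  rw [Matrix.mulVec_mulVec, Matrix.dotProduct_mulVec, ← Matrix.vecMul_transpose, Matrix.vecMul_vecMul,
    ← Matrix.mul_assoc, hG, ← Matrix.dotProduct_mulVec]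

/-- The linear automorphism of `ℤ^{Fin 3 ⊕ Fin 3}` given by an integral matrix with a two-sided integral inverse.
[cite: Huybrechts2016K3, Ch. 14 §0.1] -/
def hypSixMatrixEquiv (M N : Matrix (Fin 3 ⊕ Fin 3) (Fin 3 ⊕ Fin 3) ℤ) (h₁ : M * N = 1) (h₂ : N * M = 1) :
    (Fin 3 ⊕ Fin 3 → ℤ) ≃ₗ[ℤ] (Fin 3 ⊕ Fin 3 → ℤ) :=
  LinearEquiv.ofLinear (Matrix.toLin' M) (Matrix.toLin' N)
    (by rw [← Matrix.toLin'_mul, h₁, Matrix.toLin'_one])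
    (by rw [← Matrix.toLin'_mul, h₂, Matrix.toLin'_one])

/-- `hypSixMatrixEquiv M N v = M v`. [cite: Huybrechts2016K3, Ch. 14 §0.1] -/
@[simp] theorem hypSixMatrixEquiv_apply (M N : Matrix (Fin 3 ⊕ Fin 3) (Fin 3 ⊕ Fin 3) ℤ) (h₁ : M * N = 1)
    (h₂ : N * M = 1) (v : Fin 3 ⊕ Fin 3 → ℤ) : hypSixMatrixEquiv M N h₁ h₂ v = M *ᵥ v :=
  Matrix.toLin'_apply M v

/-- **The isometry of `U^{⊕3}` attached to an integral `M` with `Mᵀ G M = G` and an integral inverse**: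
`p ↦ φ⁻¹(M φ p)`. [cite: Huybrechts2016K3, Ch. 14 §0.1 ("orthogonal group O(Λ)")] -/
def hypSixIsometryEquiv (M N : Matrix (Fin 3 ⊕ Fin 3) (Fin 3 ⊕ Fin 3) ℤ) (hG : Mᵀ * hypSixGram * M = hypSixGram)
    (h₁ : M * N = 1) (h₂ : N * M = 1) : (hyperbolicSum 3).IsometryEquiv (hyperbolicSum 3) :=
  { hypSixCoord.trans ((hypSixMatrixEquiv M N h₁ h₂).trans hypSixCoord.symm) with
    map_app' := fun p q ↦ by
      change hyperbolicSum 3 (hypSixCoord.symm (hypSixMatrixEquiv M N h₁ h₂ (hypSixCoord p)))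
        (hypSixCoord.symm (hypSixMatrixEquiv M N h₁ h₂ (hypSixCoord q))) = hyperbolicSum 3 p q
      rw [hyperbolicSum_three_eq_dotProduct, hyperbolicSum_three_eq_dotProduct p q, LinearEquiv.apply_symm_apply,
        LinearEquiv.apply_symm_apply, hypSixMatrixEquiv_apply, hypSixMatrixEquiv_apply,
        dotProduct_mulVec_eq_of_transpose_mul_mul hG] }

/-- In coordinates the isometry is `M`: `φ(g p) = M φp`. [cite: Huybrechts2016K3, Ch. 14 §0.1] -/
theorem hypSixCoord_hypSixIsometryEquiv (M N : Matrix (Fin 3 ⊕ Fin 3) (Fin 3 ⊕ Fin 3) ℤ)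
    (hG : Mᵀ * hypSixGram * M = hypSixGram) (h₁ : M * N = 1) (h₂ : N * M = 1) (p : (Fin 3 → ℤ) × (Fin 3 → ℤ)) :
    hypSixCoord (hypSixIsometryEquiv M N hG h₁ h₂ p) = M *ᵥ hypSixCoord p := by
  change hypSixCoord (hypSixCoord.symm (hypSixMatrixEquiv M N h₁ h₂ (hypSixCoord p))) = _
  rw [LinearEquiv.apply_symm_apply, hypSixMatrixEquiv_apply]

/-- **The same map is an isometry of `U(2)^{⊕3}`** (`O(Λ(m)) = O(Λ)`). [cite: Huybrechts2016K3, Ch. 14 §0.3 (iv) ("twist Λ(m)")] -/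
def hypSixIsometryEquivTwo (M N : Matrix (Fin 3 ⊕ Fin 3) (Fin 3 ⊕ Fin 3) ℤ) (hG : Mᵀ * hypSixGram * M = hypSixGram)
    (h₁ : M * N = 1) (h₂ : N * M = 1) : ((2 : ℤ) • hyperbolicSum 3).IsometryEquiv ((2 : ℤ) • hyperbolicSum 3) :=
  { (hypSixIsometryEquiv M N hG h₁ h₂ : ((Fin 3 → ℤ) × (Fin 3 → ℤ)) ≃ₗ[ℤ] ((Fin 3 → ℤ) × (Fin 3 → ℤ))) with
    map_app' := fun p q ↦ by
      change ((2 : ℤ) • hyperbolicSum 3) (hypSixIsometryEquiv M N hG h₁ h₂ p) (hypSixIsometryEquiv M N hG h₁ h₂ q) = _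
      rw [LinearMap.smul_apply, LinearMap.smul_apply, LinearMap.smul_apply, LinearMap.smul_apply,
        LinearMap.BilinForm.IsometryEquiv.map_app] }

/-- `hypSixIsometryEquivTwo` and `hypSixIsometryEquiv` are the same map. [cite: Huybrechts2016K3, Ch. 14 §0.3 (iv)] -/
@[simp] theorem hypSixIsometryEquivTwo_apply (M N : Matrix (Fin 3 ⊕ Fin 3) (Fin 3 ⊕ Fin 3) ℤ)
    (hG : Mᵀ * hypSixGram * M = hypSixGram) (h₁ : M * N = 1) (h₂ : N * M = 1) (p : (Fin 3 → ℤ) × (Fin 3 → ℤ)) :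
    hypSixIsometryEquivTwo M N hG h₁ h₂ p = hypSixIsometryEquiv M N hG h₁ h₂ p := rfl

/-! ### §2 The dictionary `A_{U(2)^{⊕3}} ⥲ 𝔽₂⁶` -/

/-- The `ℤ`-basis `e₀, e₁, e₂, f₀, f₁, f₂` of `U^{⊕3}` indexed by `Fin 3 ⊕ Fin 3` (coordinates `φ`).
[cite: Huybrechts2016K3, Ch. 14 §0.3 (ii)] -/
def hypSixBasis : Basis (Fin 3 ⊕ Fin 3) ℤ ((Fin 3 → ℤ) × (Fin 3 → ℤ)) :=
  (Pi.basisFun ℤ (Fin 3 ⊕ Fin 3)).map hypSixCoord.symm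

/-- The coordinates in `hypSixBasis` are `φ`. [cite: Huybrechts2016K3, Ch. 14 §0.3 (ii)] -/
@[simp] theorem hypSixBasis_repr (p : (Fin 3 → ℤ) × (Fin 3 → ℤ)) (i : Fin 3 ⊕ Fin 3) :
    hypSixBasis.repr p i = hypSixCoord p i := by
  simp [hypSixBasis, Basis.map_repr, Pi.basisFun_repr]

/-- **The dictionary `Θ : A_{U(2)^{⊕3}} ⥲ 𝔽₂⁶ = U^{⊕3}/2U^{⊕3}`**, `[i_U(x)] ↦ x mod 2` in the basis `e, f`
(`A_{Λ(2)} ≅ Λ/2Λ` for unimodular `Λ`). [cite: Huybrechts2016K3, Ch. 14 §0.3 (iv) ("`0 → Λ/mΛ → A_{Λ(m)} → A_Λ → 0`")] -/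
def hypSixTheta : ((2 : ℤ) • hyperbolicSum 3).discriminantGroup ≃ₗ[ℤ] (Fin 3 ⊕ Fin 3 → ZMod 2) :=
  (hyperbolicSum 3).discriminantGroupSmulEquivPiZMod 2 (isUnimodular_hyperbolicSum 3) hypSixBasis

/-- `Θ[i_U(x)] = φx mod 2`. [cite: Huybrechts2016K3, Ch. 14 §0.3 (iv)] -/
theorem hypSixTheta_mk (x : (Fin 3 → ℤ) × (Fin 3 → ℤ)) :
    hypSixTheta (Submodule.Quotient.mk (hyperbolicSum 3 x)) = fun i ↦ ((hypSixCoord x i : ℤ) : ZMod 2) := by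
  have h := (hyperbolicSum 3).discriminantGroupSmulEquivPiZMod_mk_apply 2 (isUnimodular_hyperbolicSum 3)
    hypSixBasis x
  simp only [hypSixBasis_repr] at h
  exact h

/-- Every class of `A_{U(2)^{⊕3}}` is `[i_U(x)]` for some `x ∈ U^{⊕3}` (`A_U = 0`).
[cite: Huybrechts2016K3, Ch. 14 §0.3 (iv)] -/
theorem exists_mk_hyperbolicSum_eq (a : ((2 : ℤ) • hyperbolicSum 3).discriminantGroup) :
    ∃ x : (Fin 3 → ℤ) × (Fin 3 → ℤ), Submodule.Quotient.mk (hyperbolicSum 3 x) = a := by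
  obtain ⟨a', rfl⟩ := (hyperbolicSum 3).twistIncl_surjective_of_isUnimodular 2 (isUnimodular_hyperbolicSum 3) a
  obtain ⟨x, rfl⟩ := Submodule.Quotient.mk_surjective _ a'
  exact ⟨x, ((hyperbolicSum 3).twistIncl_mk 2 x).symm⟩

/-- `q̄(φx mod 2) = x₁⬝x₂ mod 2` (`½(x.x) = u⬝v` for `x = (u, v)`). [cite: Huybrechts2016K3, Ch. 14 §0.3 (iv)] -/
theorem hypSixQuadTwo_intCast_hypSixCoord (x : (Fin 3 → ℤ) × (Fin 3 → ℤ)) :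
    hypSixQuadTwo (fun i ↦ ((hypSixCoord x i : ℤ) : ZMod 2)) = ((x.1 ⬝ᵥ x.2 : ℤ) : ZMod 2) := by
  simp only [hypSixQuadTwo, hypSixCoord_apply, Sum.elim_inl, Sum.elim_inr, dotProduct, Fin.sum_univ_three]
  push_cast
  ring

/-- `n mod 2`, read in `{0, 1} ⊂ ℚ`, and `n` have the same class in `ℚ/2ℤ`. [folklore] -/
private theorem addCircle_coe_val_intCast (n : ℤ) :
    ((((n : ZMod 2).val : ℤ) : ℚ) : AddCircle (2 : ℚ)) = ((n : ℚ) : AddCircle (2 : ℚ)) := by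
  have hz : ((((n : ZMod 2).val : ℕ) : ℤ) : ZMod 2) = ((n : ℤ) : ZMod 2) := by
    rw [Int.cast_natCast, ZMod.natCast_zmod_val]
  obtain ⟨k, hk⟩ := (ZMod.intCast_eq_intCast_iff_dvd_sub _ _ 2).1 hz
  rw [eq_comm, ← sub_eq_zero, ← QuotientAddGroup.mk_sub, ← Int.cast_sub, hk, AddCircle.coe_eq_zero_iff]
  refine ⟨k, ?_⟩
  rw [zsmul_eq_mul, mul_comm]
  push_cast
  ring

/-- The classes of `0, 1 ∈ ℚ` in `ℚ/2ℤ` separate `𝔽₂`. [folklore] -/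
private theorem zmod_two_eq_of_addCircle_eq {z z' : ZMod 2}
    (h : (((z.val : ℤ) : ℚ) : AddCircle (2 : ℚ)) = (((z'.val : ℤ) : ℚ) : AddCircle (2 : ℚ))) : z = z' := by
  rw [← sub_eq_zero, ← QuotientAddGroup.mk_sub, ← Int.cast_sub, AddCircle.coe_eq_zero_iff] at h
  obtain ⟨k, hk⟩ := h
  rw [zsmul_eq_mul, show (k : ℚ) * 2 = ((k * 2 : ℤ) : ℚ) by push_cast; ring] at hk
  have hk' := Int.cast_injective hk
  have h₁ := z.val_lt
  have h₂ := z'.val_lt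
  apply ZMod.val_injective
  omega

/-- **`q(a) = q̄(Θ a) mod 2ℤ`**: under the dictionary the discriminant quadratic form of `U(2)^{⊕3}` is
`q̄ = v(e₀)v(f₀) + v(e₁)v(f₁) + v(e₂)v(f₂)` read in `{0, 1} ⊂ ℚ/2ℤ`. [cite: Huybrechts2016K3, Ch. 14 §0.3 (iv), Prop. 3.14 (iv)] -/
theorem discriminantQuad_eq_hypSixQuadTwo (a : ((2 : ℤ) • hyperbolicSum 3).discriminantGroup) :
    ((2 : ℤ) • hyperbolicSum 3).discriminantQuad (nondegenerate_smul_hyperbolicSum 2 3 two_ne_zero)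
        (isSymm_smul_hyperbolicSum 2 3) (isEven_smul_hyperbolicSum 2 3) a =
      ((((hypSixQuadTwo (hypSixTheta a)).val : ℤ) : ℚ) : AddCircle (2 : ℚ)) := by
  obtain ⟨x, rfl⟩ := exists_mk_hyperbolicSum_eq a
  rw [discriminantQuad_two_smul_hyperbolicSum_mk, hypSixTheta_mk, hypSixQuadTwo_intCast_hypSixCoord,
    addCircle_coe_val_intCast]

/-! ### §3 Every isometry of `(A_{U(2)^{⊕3}}, q)` lifts to `O(U(2)^{⊕3})` -/

/-- **`ḡ` is the reduction of `M` modulo `2`**: for the isometry `g` attached to `M`,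
`Θ(ḡ[i_U x]) = (M φx) mod 2`. [cite: Huybrechts2016K3, Ch. 14 §0.1 ("O(Λ) → O(A_Λ)")] -/
theorem hypSixTheta_discriminantGroupCongr_mk (M N : Matrix (Fin 3 ⊕ Fin 3) (Fin 3 ⊕ Fin 3) ℤ)
    (hG : Mᵀ * hypSixGram * M = hypSixGram) (h₁ : M * N = 1) (h₂ : N * M = 1) (x : (Fin 3 → ℤ) × (Fin 3 → ℤ)) :
    hypSixTheta ((hypSixIsometryEquivTwo M N hG h₁ h₂).discriminantGroupCongr
        (Submodule.Quotient.mk (hyperbolicSum 3 x))) =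
      fun i ↦ (((M *ᵥ hypSixCoord x) i : ℤ) : ZMod 2) := by
  set g := hypSixIsometryEquivTwo M N hG h₁ h₂ with hg
  have hdual : (g : ((Fin 3 → ℤ) × (Fin 3 → ℤ)) ≃ₗ[ℤ] ((Fin 3 → ℤ) × (Fin 3 → ℤ))).symm.dualMap
      (hyperbolicSum 3 x) = hyperbolicSum 3 (g x) := by
    refine LinearMap.ext fun y ↦ ?_
    rw [LinearEquiv.dualMap_apply]
    change hyperbolicSum 3 x ((g : ((Fin 3 → ℤ) × (Fin 3 → ℤ)) ≃ₗ[ℤ] ((Fin 3 → ℤ) × (Fin 3 → ℤ))).symm y) =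
      hyperbolicSum 3 (g x) y
    conv_rhs => rw [← (g : ((Fin 3 → ℤ) × (Fin 3 → ℤ)) ≃ₗ[ℤ] ((Fin 3 → ℤ) × (Fin 3 → ℤ))).apply_symm_apply y]
    exact ((hypSixIsometryEquiv M N hG h₁ h₂).map_app
      ((g : ((Fin 3 → ℤ) × (Fin 3 → ℤ)) ≃ₗ[ℤ] ((Fin 3 → ℤ) × (Fin 3 → ℤ))).symm y) x).symm
  rw [LinearMap.BilinForm.IsometryEquiv.discriminantGroupCongr_mk, hdual, hypSixTheta_mk]
  funext i
  rw [show hypSixCoord (g x) = M *ᵥ hypSixCoord x from hypSixCoord_hypSixIsometryEquiv M N hG h₁ h₂ x]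

/-- **Nikulin's Thm. 1.14.2 for `U(2)^{⊕3}`: every isometry of the discriminant form `(A_{U(2)^{⊕3}}, q)` is induced
by an isometry of `U(2)^{⊕3}`** — the lifting hypothesis `hlift` of
`exists_isometryEquiv_comp_eq_of_primitive_kummer_of_forall_lift` (Huybrechts Cor. 3.15 via Rem. 1.13 (i): the
boundary case `rk = ℓ(A_2) = 6` of Thm. 1.14.2, where `q ≅ u₊(2)^{⊕3}` splits off `u₊(2)`).
[cite: Nikulin1980, Thm. 1.14.2] [cite: Huybrechts2016K3, Ch. 14 Thm. 2.4, Rem. 1.13 (i), Cor. 3.15] -/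
theorem forall_lift_two_smul_hyperbolicSum_three :
    ∀ δ : ((2 : ℤ) • hyperbolicSum 3).discriminantGroup ≃ₗ[ℤ] ((2 : ℤ) • hyperbolicSum 3).discriminantGroup,
      (∀ a, ((2 : ℤ) • hyperbolicSum 3).discriminantQuad (nondegenerate_smul_hyperbolicSum 2 3 two_ne_zero)
          (isSymm_smul_hyperbolicSum 2 3) (isEven_smul_hyperbolicSum 2 3) (δ a) =
        ((2 : ℤ) • hyperbolicSum 3).discriminantQuad (nondegenerate_smul_hyperbolicSum 2 3 two_ne_zero)
          (isSymm_smul_hyperbolicSum 2 3) (isEven_smul_hyperbolicSum 2 3) a) →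
      ∃ g : ((2 : ℤ) • hyperbolicSum 3).IsometryEquiv ((2 : ℤ) • hyperbolicSum 3),
        ∀ a, g.discriminantGroupCongr a = δ a := by
  intro δ hδ
  -- the `𝔽₂`-matrix `D` of `Θ ∘ δ ∘ Θ⁻¹`
  set T : (Fin 3 ⊕ Fin 3 → ZMod 2) ≃ₗ[ℤ] (Fin 3 ⊕ Fin 3 → ZMod 2) :=
    hypSixTheta.symm ≪≫ₗ (δ ≪≫ₗ hypSixTheta) with hT
  set D : Matrix (Fin 3 ⊕ Fin 3) (Fin 3 ⊕ Fin 3) (ZMod 2) :=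
    LinearMap.toMatrix' (T.toLinearMap.toAddMonoidHom.toZModLinearMap 2) with hD
  have hDv : ∀ v, D *ᵥ v = hypSixTheta (δ (hypSixTheta.symm v)) := fun v ↦ by
    rw [hD, LinearMap.toMatrix'_mulVec]
    rfl
  -- `D` is `q̄`-orthogonal (dictionary) and injective
  have hq : ∀ v, hypSixQuadTwo (D *ᵥ v) = hypSixQuadTwo v := fun v ↦ by
    rw [hDv]
    apply zmod_two_eq_of_addCircle_eq
    rw [← discriminantQuad_eq_hypSixQuadTwo, hδ, discriminantQuad_eq_hypSixQuadTwo, LinearEquiv.apply_symm_apply]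
  have hinj : Function.Injective D.mulVec := by
    intro u v huv
    have h : D *ᵥ u = D *ᵥ v := huv
    rw [hDv, hDv] at h
    exact hypSixTheta.symm.injective (δ.injective (hypSixTheta.injective h))
  -- lift `D` to an integral isometry `M` and take the attached isometry of `U(2)^{⊕3}`
  obtain ⟨M, N, hG, h₁, h₂, hM⟩ := exists_integral_lift_of_orthogonal_mod_two D hq hinj
  refine ⟨hypSixIsometryEquivTwo M N hG h₁ h₂, fun a ↦ ?_⟩
  obtain ⟨x, rfl⟩ := exists_mk_hyperbolicSum_eq a
  apply hypSixTheta.injective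
  rw [hypSixTheta_discriminantGroupCongr_mk]
  have h := hDv (hypSixTheta (Submodule.Quotient.mk (hyperbolicSum 3 x)))
  rw [LinearEquiv.symm_apply_apply] at h
  rw [← h, hypSixTheta_mk, ← hM]
  funext i
  exact RingHom.map_mulVec (Int.castRingHom (ZMod 2)) M (hypSixCoord x) i

end Literature.Topology.FourManifolds
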